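import Mathlib
import Literature.NumberTheory.Transcendental.KZDominatedFamilyRelations
import Summits.KontsevichZagierPeriods.KontsevichZagierPeriods.Theorems.InverseLandauTateLiftingIsotropySpaceChart

/-!
# `TateLifting` (stmt-KontsevichZagierPeriods-9129), line `Sketch` — stub 53 `IsotropySpace` (i):
# the space engine of hard-sphere cluster integrals

The statement `tateLifting_isotropySpaceMove` below is VERBATIM the open crux
`IsotropyFactorisation3` of route HardSphereVirial (stmt-KontsevichZagierPeriods-10457,
`Summit.KontsevichZagierPeriods.KontsevichZagierPeriods.Theses.HardSphereVirial.IsotropyFactorisation3`),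
so that that item can be closed by `exact tateLifting_isotropySpaceMove`; it is conjunct (i) of
`IsotropySpace` (stub 53) of the skeleton `Cruxes/TateLifting/Lines/Sketch.lean`.

**Statement.** Let `σ ⊆ (ℝ³)³ = ℝ⁹` (three points `x₂ = (x 0, x 1, x 2)`, `x₃ = (x 3, x 4, x 5)`,
`x₄ = (x 6, x 7, x 8)`) be `ℚ`-semialgebraic and invariant under the simultaneous action of every
orthogonal `3 × 3` matrix on the three points; let `r = [σ, 1]` and let `q` be the REDUCED
representation on `{w | ρ := w 2 > 0, ((0, 0, ρ), (w 3, w 4, w 5), (w 6, w 7, w 8)) ∈ σ}` with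
integrand `4ρ²/(1 + a² + b²)²`, `(a, b) := (w 0, w 1)`. Then `[r] − [q] ∈ KZ.relations`.

**Proof (inside the rules of the Kontsevich–Zagier calculus).**
* (1a) Excise from `σ` the null set `N = {x | x 0 = 0 ∧ x 1 = 0 ∧ x 2 ≤ 0}` (first point on the
  closed southern axis): `[σ, 1] − [σ ∖ N, 1] ∈ relations`.
* (2) ONE change of variables from `q` onto `[σ ∖ N, 1]` along
  `Ψ(a, b, ρ, y₃, y₄) = (ρ ω, M y₃, M y₄)`, `ω(a,b) = (2a, 2b, 1 − a² − b²)/(1 + a² + b²)` the inverse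
  stereographic direction and `M(a,b) = (e, g, p; g, f, q; p, q, t)` the RATIONAL rotation by `π`
  about `(a, b, 1)` (`M e₃ = ω`, `Mᵀ = M = M⁻¹`, `det M = 1`). Its Jacobian is block lower-triangular
  with diagonal blocks `(ρ ∂_a ω, ρ ∂_b ω, ω)` (determinant `4ρ²/(1+a²+b²)²`) and two copies of `M`
  (determinant `1`); `Ψ` is injective on `{ρ > 0}` and maps the reduced domain onto `σ ∖ N` by the
  invariance hypothesis applied to `R = M` (the inverse is `ρ = |x₂|`, `(a, b) = (x 0, x 1)/(ρ + x 2)`,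
  `y₃ = M x₃`, `y₄ = M x₄`), and `4ρ²/(1+a²+b²)² = 1 · |det Ψ′|`.

Design: no definitions (pure proof file). The six frame functions, their twelve partials, the chart
`Ψ` and its Jacobian `Ψ′` are section variables constrained by defining equations (instantiated by
`rfl` in the final proof); the block Jacobian, the frame algebra and the partial derivatives are in
the auxiliary files `…IsotropySpaceAux.lean`, `…IsotropySpaceDeriv.lean`.

References: M. Kontsevich, D. Zagier, *Periods* (2001), §1.2 rules (1), (2); L. Santaló, *Integral
Geometry and Geometric Probability* (2004), §I.1; J. Bochnak, M. Coste, M.-F. Roy, *Real Algebraic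
Geometry* (1998), §2.2.
-/

noncomputable section

open MeasureTheory Set
open Literature.NumberTheory.Transcendental
open Literature.ModelTheory.ExponentialFields (IsSemialgebraic isSemialgebraic_setOf_eval_eq_zero
  isSemialgebraic_setOf_eval_nonneg)

namespace Summit.KontsevichZagierPeriods.InverseLandau

namespace IsotropySpace

section Chart

variable {p q t e f g : ℝ → ℝ → ℝ}
  (hp : ∀ a b, p a b = 2 * a / (1 + a ^ 2 + b ^ 2))
  (hq : ∀ a b, q a b = 2 * b / (1 + a ^ 2 + b ^ 2))
  (ht : ∀ a b, t a b = (1 - a ^ 2 - b ^ 2) / (1 + a ^ 2 + b ^ 2))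
  (he : ∀ a b, e a b = (a ^ 2 - b ^ 2 - 1) / (1 + a ^ 2 + b ^ 2))
  (hf : ∀ a b, f a b = (b ^ 2 - a ^ 2 - 1) / (1 + a ^ 2 + b ^ 2))
  (hg : ∀ a b, g a b = 2 * a * b / (1 + a ^ 2 + b ^ 2))
variable {pa pb qa qb ta tb ea eb fa fb ga gb : ℝ → ℝ → ℝ}
  (hpa : ∀ a b, pa a b = (2 + 2 * b ^ 2 - 2 * a ^ 2) / (1 + a ^ 2 + b ^ 2) ^ 2)
  (hpb : ∀ a b, pb a b = -(4 * a * b) / (1 + a ^ 2 + b ^ 2) ^ 2)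
  (hqa : ∀ a b, qa a b = -(4 * a * b) / (1 + a ^ 2 + b ^ 2) ^ 2)
  (hqb : ∀ a b, qb a b = (2 + 2 * a ^ 2 - 2 * b ^ 2) / (1 + a ^ 2 + b ^ 2) ^ 2)
  (hta : ∀ a b, ta a b = -(4 * a) / (1 + a ^ 2 + b ^ 2) ^ 2)
  (htb : ∀ a b, tb a b = -(4 * b) / (1 + a ^ 2 + b ^ 2) ^ 2)
  (hea : ∀ a b, ea a b = 4 * a * (1 + b ^ 2) / (1 + a ^ 2 + b ^ 2) ^ 2)
  (heb : ∀ a b, eb a b = -(4 * a ^ 2 * b) / (1 + a ^ 2 + b ^ 2) ^ 2)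
  (hfa : ∀ a b, fa a b = -(4 * a * b ^ 2) / (1 + a ^ 2 + b ^ 2) ^ 2)
  (hfb : ∀ a b, fb a b = 4 * b * (1 + a ^ 2) / (1 + a ^ 2 + b ^ 2) ^ 2)
  (hga : ∀ a b, ga a b = 2 * b * (1 + b ^ 2 - a ^ 2) / (1 + a ^ 2 + b ^ 2) ^ 2)
  (hgb : ∀ a b, gb a b = 2 * a * (1 + a ^ 2 - b ^ 2) / (1 + a ^ 2 + b ^ 2) ^ 2)

/-! ### The chart `Ψ(a, b, ρ, y₃, y₄) = (ρ ω, M y₃, M y₄)` and its Jacobian -/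

variable {Ψ : (Fin 9 → ℝ) → Fin 9 → ℝ}
  (hΨ : ∀ w, Ψ w = ![w 2 * p (w 0) (w 1), w 2 * q (w 0) (w 1), w 2 * t (w 0) (w 1),
    e (w 0) (w 1) * w 3 + g (w 0) (w 1) * w 4 + p (w 0) (w 1) * w 5,
    g (w 0) (w 1) * w 3 + f (w 0) (w 1) * w 4 + q (w 0) (w 1) * w 5,
    p (w 0) (w 1) * w 3 + q (w 0) (w 1) * w 4 + t (w 0) (w 1) * w 5,
    e (w 0) (w 1) * w 6 + g (w 0) (w 1) * w 7 + p (w 0) (w 1) * w 8,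
    g (w 0) (w 1) * w 6 + f (w 0) (w 1) * w 7 + q (w 0) (w 1) * w 8,
    p (w 0) (w 1) * w 6 + q (w 0) (w 1) * w 7 + t (w 0) (w 1) * w 8])
  {Ψ' : (Fin 9 → ℝ) → (Fin 9 → ℝ) →L[ℝ] (Fin 9 → ℝ)}
  (hΨ' : ∀ x, Ψ' x = LinearMap.toContinuousLinearMap (Matrix.toLin'
    (Matrix.reindex finSumFinEquiv finSumFinEquiv
      (Matrix.fromBlocks
        !![x 2 * pa (x 0) (x 1), x 2 * pb (x 0) (x 1), p (x 0) (x 1);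
           x 2 * qa (x 0) (x 1), x 2 * qb (x 0) (x 1), q (x 0) (x 1);
           x 2 * ta (x 0) (x 1), x 2 * tb (x 0) (x 1), t (x 0) (x 1)]
        0
        !![ea (x 0) (x 1) * x 3 + ga (x 0) (x 1) * x 4 + pa (x 0) (x 1) * x 5,
             eb (x 0) (x 1) * x 3 + gb (x 0) (x 1) * x 4 + pb (x 0) (x 1) * x 5, 0;
           ga (x 0) (x 1) * x 3 + fa (x 0) (x 1) * x 4 + qa (x 0) (x 1) * x 5,
             gb (x 0) (x 1) * x 3 + fb (x 0) (x 1) * x 4 + qb (x 0) (x 1) * x 5, 0;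
           pa (x 0) (x 1) * x 3 + qa (x 0) (x 1) * x 4 + ta (x 0) (x 1) * x 5,
             pb (x 0) (x 1) * x 3 + qb (x 0) (x 1) * x 4 + tb (x 0) (x 1) * x 5, 0;
           ea (x 0) (x 1) * x 6 + ga (x 0) (x 1) * x 7 + pa (x 0) (x 1) * x 8,
             eb (x 0) (x 1) * x 6 + gb (x 0) (x 1) * x 7 + pb (x 0) (x 1) * x 8, 0;
           ga (x 0) (x 1) * x 6 + fa (x 0) (x 1) * x 7 + qa (x 0) (x 1) * x 8,
             gb (x 0) (x 1) * x 6 + fb (x 0) (x 1) * x 7 + qb (x 0) (x 1) * x 8, 0;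
           pa (x 0) (x 1) * x 6 + qa (x 0) (x 1) * x 7 + ta (x 0) (x 1) * x 8,
             pb (x 0) (x 1) * x 6 + qb (x 0) (x 1) * x 7 + tb (x 0) (x 1) * x 8, 0]
        (Matrix.reindex finSumFinEquiv finSumFinEquiv
          (Matrix.fromBlocks
            !![e (x 0) (x 1), g (x 0) (x 1), p (x 0) (x 1);
               g (x 0) (x 1), f (x 0) (x 1), q (x 0) (x 1);
               p (x 0) (x 1), q (x 0) (x 1), t (x 0) (x 1)]
            0 0
            !![e (x 0) (x 1), g (x 0) (x 1), p (x 0) (x 1);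
               g (x 0) (x 1), f (x 0) (x 1), q (x 0) (x 1);
               p (x 0) (x 1), q (x 0) (x 1), t (x 0) (x 1)]))) : Matrix (Fin 9) (Fin 9) ℝ)))

include hp hq ht he hf hg hΨ in
/-- The chart is injective on `{ρ > 0}`. [folklore] -/
theorem chart_injOn : InjOn Ψ {w | 0 < w 2} := by
  intro w hw w' hw' h
  have hw2 : 0 < w 2 := hw
  have hw2' : 0 < w' 2 := hw'
  have E : ∀ i, Ψ w i = Ψ w' i := fun i => by rw [h]
  have e0 := E 0
  have e1 := E 1
  have e2 := E 2
  have e3 := E 3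
  have e4 := E 4
  have e5 := E 5
  have e6 := E 6
  have e7 := E 7
  have e8 := E 8
  simp only [hΨ, Matrix.cons_val] at e0 e1 e2 e3 e4 e5 e6 e7 e8
  obtain ⟨O1, O2, O3, O4, O5, O6⟩ := frame_orthonormal hp hq ht he hf hg (w 0) (w 1)
  obtain ⟨O1', O2', O3', O4', O5', O6'⟩ := frame_orthonormal hp hq ht he hf hg (w' 0) (w' 1)
  -- radius: `ρ² = |ρ ω|²`
  have h22 : w 2 ^ 2 = w' 2 ^ 2 := by
    linear_combination (w 2 * p (w 0) (w 1) + w' 2 * p (w' 0) (w' 1)) * e0 +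
      (w 2 * q (w 0) (w 1) + w' 2 * q (w' 0) (w' 1)) * e1 +
      (w 2 * t (w 0) (w 1) + w' 2 * t (w' 0) (w' 1)) * e2 - (w 2) ^ 2 * O3 + (w' 2) ^ 2 * O3'
  have h2 : w 2 = w' 2 := (pow_left_inj₀ hw2.le hw2'.le two_ne_zero).1 h22
  rw [← h2] at e0 e1 e2
  have hpp : p (w 0) (w 1) = p (w' 0) (w' 1) := mul_left_cancel₀ hw2.ne' e0
  have hqq : q (w 0) (w 1) = q (w' 0) (w' 1) := mul_left_cancel₀ hw2.ne' e1
  have htt : t (w 0) (w 1) = t (w' 0) (w' 1) := mul_left_cancel₀ hw2.ne' e2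
  obtain ⟨h0, h1⟩ := stereo_inj hp hq ht hpp hqq htt
  rw [← h0, ← h1] at e3 e4 e5 e6 e7 e8
  have h3 : w 3 = w' 3 := by
    linear_combination e (w 0) (w 1) * e3 + g (w 0) (w 1) * e4 + p (w 0) (w 1) * e5 -
      (w 3 - w' 3) * O1 - (w 4 - w' 4) * O4 - (w 5 - w' 5) * O5
  have h4 : w 4 = w' 4 := by
    linear_combination g (w 0) (w 1) * e3 + f (w 0) (w 1) * e4 + q (w 0) (w 1) * e5 -
      (w 3 - w' 3) * O4 - (w 4 - w' 4) * O2 - (w 5 - w' 5) * O6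
  have h5 : w 5 = w' 5 := by
    linear_combination p (w 0) (w 1) * e3 + q (w 0) (w 1) * e4 + t (w 0) (w 1) * e5 -
      (w 3 - w' 3) * O5 - (w 4 - w' 4) * O6 - (w 5 - w' 5) * O3
  have h6 : w 6 = w' 6 := by
    linear_combination e (w 0) (w 1) * e6 + g (w 0) (w 1) * e7 + p (w 0) (w 1) * e8 -
      (w 6 - w' 6) * O1 - (w 7 - w' 7) * O4 - (w 8 - w' 8) * O5
  have h7 : w 7 = w' 7 := by
    linear_combination g (w 0) (w 1) * e6 + f (w 0) (w 1) * e7 + q (w 0) (w 1) * e8 -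
      (w 6 - w' 6) * O4 - (w 7 - w' 7) * O2 - (w 8 - w' 8) * O6
  have h8 : w 8 = w' 8 := by
    linear_combination p (w 0) (w 1) * e6 + q (w 0) (w 1) * e7 + t (w 0) (w 1) * e8 -
      (w 6 - w' 6) * O5 - (w 7 - w' 7) * O6 - (w 8 - w' 8) * O3
  funext i
  fin_cases i <;> assumption

include hp hq ht he hf hg hΨ in
/-- The chart maps the reduced domain `{ρ > 0, ((0,0,ρ), y₃, y₄) ∈ σ}` ONTO `σ ∖ N`,
`N = {x 0 = 0, x 1 = 0, x 2 ≤ 0}`, for every `σ` invariant under the diagonal action of `O(3)`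
(rotate by `M = Mᵀ = M⁻¹` both ways). [folklore] -/
theorem chart_image (σ : Set (Fin 9 → ℝ))
    (hO : ∀ R : Matrix (Fin 3) (Fin 3) ℝ, R.transpose * R = 1 → ∀ x : Fin 9 → ℝ,
      x ∈ σ ↔ (![(R.mulVec ![x 0, x 1, x 2]) 0, (R.mulVec ![x 0, x 1, x 2]) 1, (R.mulVec ![x 0, x 1, x 2]) 2,
        (R.mulVec ![x 3, x 4, x 5]) 0, (R.mulVec ![x 3, x 4, x 5]) 1, (R.mulVec ![x 3, x 4, x 5]) 2,
        (R.mulVec ![x 6, x 7, x 8]) 0, (R.mulVec ![x 6, x 7, x 8]) 1, (R.mulVec ![x 6, x 7, x 8]) 2] :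
          Fin 9 → ℝ) ∈ σ) :
    Ψ '' {w | 0 < w 2 ∧ (![0, 0, w 2, w 3, w 4, w 5, w 6, w 7, w 8] : Fin 9 → ℝ) ∈ σ} =
      σ \ {x | x 0 = 0 ∧ x 1 = 0 ∧ x 2 ≤ 0} := by
  apply Subset.antisymm
  · rintro _ ⟨w, ⟨hw2, hwσ⟩, rfl⟩
    have hw2 : 0 < w 2 := hw2
    obtain ⟨O1, O2, O3, O4, O5, O6⟩ := frame_orthonormal hp hq ht he hf hg (w 0) (w 1)
    refine ⟨?_, ?_⟩
    · have h := (hO _ (frame_transpose_mul_self hp hq ht he hf hg (w 0) (w 1)) _).1 hwσ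
      simp only [mulVec_three, Matrix.of_apply, Matrix.cons_val', Matrix.cons_val, Matrix.empty_val',
        Matrix.cons_val_fin_one] at h
      convert h using 1
      rw [hΨ]
      funext i
      fin_cases i <;> simp only [Matrix.cons_val, Fin.reduceFinMk] <;> ring
    · rintro ⟨h0, h1, h2⟩
      rw [hΨ] at h0 h1 h2
      simp only [Matrix.cons_val] at h0 h1 h2
      have hp0 : p (w 0) (w 1) = 0 := (mul_eq_zero.1 h0).resolve_left hw2.ne'
      have hq0 : q (w 0) (w 1) = 0 := (mul_eq_zero.1 h1).resolve_left hw2.ne'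
      have ha : w 0 = 0 := by
        rw [← p_div_one_add_t hp ht (w 0) (w 1), hp0, zero_div]
      have hb : w 1 = 0 := by
        rw [← q_div_one_add_t hq ht (w 0) (w 1), hq0, zero_div]
      rw [ha, hb, ht] at h2
      norm_num at h2
      linarith
  · rintro x ⟨hxσ, hxN⟩
    obtain ⟨a, b, ρ, hρ, hx0, hx1, hx2⟩ := polar_exists hp hq ht (x 0) (x 1) (x 2) hxN
    obtain ⟨O1, O2, O3, O4, O5, O6⟩ := frame_orthonormal hp hq ht he hf hg a b
    have h := (hO _ (frame_transpose_mul_self hp hq ht he hf hg a b) x).1 hxσ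
    simp only [mulVec_three, Matrix.of_apply, Matrix.cons_val', Matrix.cons_val, Matrix.empty_val',
      Matrix.cons_val_fin_one] at h
    have k0 : e a b * x 0 + g a b * x 1 + p a b * x 2 = 0 := by
      rw [hx0, hx1, hx2]; linear_combination ρ * O5
    have k1 : g a b * x 0 + f a b * x 1 + q a b * x 2 = 0 := by
      rw [hx0, hx1, hx2]; linear_combination ρ * O6
    have k2 : p a b * x 0 + q a b * x 1 + t a b * x 2 = ρ := by
      rw [hx0, hx1, hx2]; linear_combination ρ * O3
    rw [k0, k1, k2] at h
    refine ⟨![a, b, ρ, e a b * x 3 + g a b * x 4 + p a b * x 5, g a b * x 3 + f a b * x 4 + q a b * x 5,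
      p a b * x 3 + q a b * x 4 + t a b * x 5, e a b * x 6 + g a b * x 7 + p a b * x 8,
      g a b * x 6 + f a b * x 7 + q a b * x 8, p a b * x 6 + q a b * x 7 + t a b * x 8], ⟨?_, ?_⟩, ?_⟩
    · show 0 < ρ
      exact hρ
    · simpa using h
    · rw [hΨ]
      funext i
      fin_cases i
      · simp only [Matrix.cons_val, Fin.reduceFinMk]
        exact hx0.symm
      · simp only [Matrix.cons_val, Fin.reduceFinMk]
        exact hx1.symm
      · simp only [Matrix.cons_val, Fin.reduceFinMk]
        exact hx2.symm
      · simp only [Matrix.cons_val, Fin.reduceFinMk]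
        linear_combination x 3 * O1 + x 4 * O4 + x 5 * O5
      · simp only [Matrix.cons_val, Fin.reduceFinMk]
        linear_combination x 3 * O4 + x 4 * O2 + x 5 * O6
      · simp only [Matrix.cons_val, Fin.reduceFinMk]
        linear_combination x 3 * O5 + x 4 * O6 + x 5 * O3
      · simp only [Matrix.cons_val, Fin.reduceFinMk]
        linear_combination x 6 * O1 + x 7 * O4 + x 8 * O5
      · simp only [Matrix.cons_val, Fin.reduceFinMk]
        linear_combination x 6 * O4 + x 7 * O2 + x 8 * O6
      · simp only [Matrix.cons_val, Fin.reduceFinMk]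
        linear_combination x 6 * O5 + x 7 * O6 + x 8 * O3

end Chart

end IsotropySpace

open IsotropySpace in
/-- **The space engine of hard-sphere cluster integrals** (conjunct (i) of stub 53 `IsotropySpace`
of the line `Sketch` for `TateLifting`, stmt-KontsevichZagierPeriods-9129; VERBATIM the crux
`IsotropyFactorisation3` of route HardSphereVirial, stmt-KontsevichZagierPeriods-10457). For a
`ℚ`-semialgebraic `σ ⊆ (ℝ³)³` invariant under the diagonal action of `O(3)`, the integrand-`1`
representation `r = [σ, 1]` differs by KZ relations from the reduced representation `q` over
`{(a, b, ρ, y₃, y₄) | ρ > 0, ((0,0,ρ), y₃, y₄) ∈ σ}` with integrand `4ρ²/(1 + a² + b²)²`: excise the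
null set `{x 0 = 0, x 1 = 0, x 2 ≤ 0}` (rule (1a)), then ONE change of variables (rule (2)) along
the stereographic-frame chart, Jacobian `|det Ψ′| = 4ρ²/(1 + a² + b²)²`.
[cite: KontsevichZagier2001, §1.2 rule (2)] -/
theorem tateLifting_isotropySpaceMove :
  ∀ (σ : Set (Fin 9 → ℝ)), Literature.ModelTheory.ExponentialFields.IsSemialgebraic ℚ σ → (∀ R : Matrix (Fin 3) (Fin 3) ℝ, R.transpose * R = 1 → ∀ x : Fin 9 → ℝ, x ∈ σ ↔ (![(R.mulVec ![x 0, x 1, x 2]) 0, (R.mulVec ![x 0, x 1, x 2]) 1, (R.mulVec ![x 0, x 1, x 2]) 2, (R.mulVec ![x 3, x 4, x 5]) 0, (R.mulVec ![x 3, x 4, x 5]) 1, (R.mulVec ![x 3, x 4, x 5]) 2, (R.mulVec ![x 6, x 7, x 8]) 0, (R.mulVec ![x 6, x 7, x 8]) 1, (R.mulVec ![x 6, x 7, x 8]) 2] : Fin 9 → ℝ) ∈ σ) → ∀ (r : Literature.NumberTheory.Transcendental.KZ.IntegralRep 9), r.domain = σ → (∀ x ∈ r.domain, r.integrand x = 1)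 → ∀ (q : Literature.NumberTheory.Transcendental.KZ.IntegralRep 9), q.domain = {w | 0 < w 2 ∧ (![0, 0, w 2, w 3, w 4, w 5, w 6, w 7, w 8] : Fin 9 → ℝ) ∈ σ} → (∀ w ∈ q.domain, q.integrand w = 4 / (1 + w 0 ^ 2 + w 1 ^ 2) ^ 2 * w 2 ^ 2) → Literature.NumberTheory.Transcendental.KZ.of r - Literature.NumberTheory.Transcendental.KZ.of q ∈ Literature.NumberTheory.Transcendental.KZ.relations := by
  intro σ _hσ hO r hr hr1 q hq hq1
  subst hr
  -- the frame functions, their partials, the chart and its Jacobian, behind defining equations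
  obtain ⟨p, hp⟩ : ∃ p : ℝ → ℝ → ℝ, ∀ a b, p a b = 2 * a / (1 + a ^ 2 + b ^ 2) := ⟨_, fun _ _ => rfl⟩
  obtain ⟨q', hq'⟩ : ∃ q' : ℝ → ℝ → ℝ, ∀ a b, q' a b = 2 * b / (1 + a ^ 2 + b ^ 2) := ⟨_, fun _ _ => rfl⟩
  obtain ⟨t, ht⟩ : ∃ t : ℝ → ℝ → ℝ, ∀ a b, t a b = (1 - a ^ 2 - b ^ 2) / (1 + a ^ 2 + b ^ 2) :=
    ⟨_, fun _ _ => rfl⟩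
  obtain ⟨e, he⟩ : ∃ e : ℝ → ℝ → ℝ, ∀ a b, e a b = (a ^ 2 - b ^ 2 - 1) / (1 + a ^ 2 + b ^ 2) :=
    ⟨_, fun _ _ => rfl⟩
  obtain ⟨f, hf⟩ : ∃ f : ℝ → ℝ → ℝ, ∀ a b, f a b = (b ^ 2 - a ^ 2 - 1) / (1 + a ^ 2 + b ^ 2) :=
    ⟨_, fun _ _ => rfl⟩
  obtain ⟨g, hg⟩ : ∃ g : ℝ → ℝ → ℝ, ∀ a b, g a b = 2 * a * b / (1 + a ^ 2 + b ^ 2) := ⟨_, fun _ _ => rfl⟩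
  obtain ⟨pa, hpa⟩ : ∃ pa : ℝ → ℝ → ℝ, ∀ a b, pa a b = (2 + 2 * b ^ 2 - 2 * a ^ 2) / (1 + a ^ 2 + b ^ 2) ^ 2 :=
    ⟨_, fun _ _ => rfl⟩
  obtain ⟨pb, hpb⟩ : ∃ pb : ℝ → ℝ → ℝ, ∀ a b, pb a b = -(4 * a * b) / (1 + a ^ 2 + b ^ 2) ^ 2 :=
    ⟨_, fun _ _ => rfl⟩
  obtain ⟨qa, hqa⟩ : ∃ qa : ℝ → ℝ → ℝ, ∀ a b, qa a b = -(4 * a * b) / (1 + a ^ 2 + b ^ 2) ^ 2 :=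
    ⟨_, fun _ _ => rfl⟩
  obtain ⟨qb, hqb⟩ : ∃ qb : ℝ → ℝ → ℝ, ∀ a b, qb a b = (2 + 2 * a ^ 2 - 2 * b ^ 2) / (1 + a ^ 2 + b ^ 2) ^ 2 :=
    ⟨_, fun _ _ => rfl⟩
  obtain ⟨ta, hta⟩ : ∃ ta : ℝ → ℝ → ℝ, ∀ a b, ta a b = -(4 * a) / (1 + a ^ 2 + b ^ 2) ^ 2 :=
    ⟨_, fun _ _ => rfl⟩
  obtain ⟨tb, htb⟩ : ∃ tb : ℝ → ℝ → ℝ, ∀ a b, tb a b = -(4 * b) / (1 + a ^ 2 + b ^ 2) ^ 2 :=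
    ⟨_, fun _ _ => rfl⟩
  obtain ⟨ea, hea⟩ : ∃ ea : ℝ → ℝ → ℝ, ∀ a b, ea a b = 4 * a * (1 + b ^ 2) / (1 + a ^ 2 + b ^ 2) ^ 2 :=
    ⟨_, fun _ _ => rfl⟩
  obtain ⟨eb, heb⟩ : ∃ eb : ℝ → ℝ → ℝ, ∀ a b, eb a b = -(4 * a ^ 2 * b) / (1 + a ^ 2 + b ^ 2) ^ 2 :=
    ⟨_, fun _ _ => rfl⟩
  obtain ⟨fa, hfa⟩ : ∃ fa : ℝ → ℝ → ℝ, ∀ a b, fa a b = -(4 * a * b ^ 2) / (1 + a ^ 2 + b ^ 2) ^ 2 :=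
    ⟨_, fun _ _ => rfl⟩
  obtain ⟨fb, hfb⟩ : ∃ fb : ℝ → ℝ → ℝ, ∀ a b, fb a b = 4 * b * (1 + a ^ 2) / (1 + a ^ 2 + b ^ 2) ^ 2 :=
    ⟨_, fun _ _ => rfl⟩
  obtain ⟨ga, hga⟩ : ∃ ga : ℝ → ℝ → ℝ, ∀ a b, ga a b = 2 * b * (1 + b ^ 2 - a ^ 2) / (1 + a ^ 2 + b ^ 2) ^ 2 :=
    ⟨_, fun _ _ => rfl⟩
  obtain ⟨gb, hgb⟩ : ∃ gb : ℝ → ℝ → ℝ, ∀ a b, gb a b = 2 * a * (1 + a ^ 2 - b ^ 2) / (1 + a ^ 2 + b ^ 2) ^ 2 :=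
    ⟨_, fun _ _ => rfl⟩
  obtain ⟨Ψ, hΨ⟩ : ∃ Ψ : (Fin 9 → ℝ) → Fin 9 → ℝ, ∀ w, Ψ w = ![w 2 * p (w 0) (w 1), w 2 * q' (w 0) (w 1),
      w 2 * t (w 0) (w 1), e (w 0) (w 1) * w 3 + g (w 0) (w 1) * w 4 + p (w 0) (w 1) * w 5,
      g (w 0) (w 1) * w 3 + f (w 0) (w 1) * w 4 + q' (w 0) (w 1) * w 5,
      p (w 0) (w 1) * w 3 + q' (w 0) (w 1) * w 4 + t (w 0) (w 1) * w 5,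
      e (w 0) (w 1) * w 6 + g (w 0) (w 1) * w 7 + p (w 0) (w 1) * w 8,
      g (w 0) (w 1) * w 6 + f (w 0) (w 1) * w 7 + q' (w 0) (w 1) * w 8,
      p (w 0) (w 1) * w 6 + q' (w 0) (w 1) * w 7 + t (w 0) (w 1) * w 8] := ⟨_, fun _ => rfl⟩
  obtain ⟨Ψ', hΨ'⟩ : ∃ Ψ' : (Fin 9 → ℝ) → (Fin 9 → ℝ) →L[ℝ] (Fin 9 → ℝ), ∀ x, Ψ' x =
      LinearMap.toContinuousLinearMap (Matrix.toLin'
        (Matrix.reindex finSumFinEquiv finSumFinEquiv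
          (Matrix.fromBlocks
            !![x 2 * pa (x 0) (x 1), x 2 * pb (x 0) (x 1), p (x 0) (x 1);
               x 2 * qa (x 0) (x 1), x 2 * qb (x 0) (x 1), q' (x 0) (x 1);
               x 2 * ta (x 0) (x 1), x 2 * tb (x 0) (x 1), t (x 0) (x 1)]
            0
            !![ea (x 0) (x 1) * x 3 + ga (x 0) (x 1) * x 4 + pa (x 0) (x 1) * x 5,
                 eb (x 0) (x 1) * x 3 + gb (x 0) (x 1) * x 4 + pb (x 0) (x 1) * x 5, 0;
               ga (x 0) (x 1) * x 3 + fa (x 0) (x 1) * x 4 + qa (x 0) (x 1) * x 5,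
                 gb (x 0) (x 1) * x 3 + fb (x 0) (x 1) * x 4 + qb (x 0) (x 1) * x 5, 0;
               pa (x 0) (x 1) * x 3 + qa (x 0) (x 1) * x 4 + ta (x 0) (x 1) * x 5,
                 pb (x 0) (x 1) * x 3 + qb (x 0) (x 1) * x 4 + tb (x 0) (x 1) * x 5, 0;
               ea (x 0) (x 1) * x 6 + ga (x 0) (x 1) * x 7 + pa (x 0) (x 1) * x 8,
                 eb (x 0) (x 1) * x 6 + gb (x 0) (x 1) * x 7 + pb (x 0) (x 1) * x 8, 0;
               ga (x 0) (x 1) * x 6 + fa (x 0) (x 1) * x 7 + qa (x 0) (x 1) * x 8,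
                 gb (x 0) (x 1) * x 6 + fb (x 0) (x 1) * x 7 + qb (x 0) (x 1) * x 8, 0;
               pa (x 0) (x 1) * x 6 + qa (x 0) (x 1) * x 7 + ta (x 0) (x 1) * x 8,
                 pb (x 0) (x 1) * x 6 + qb (x 0) (x 1) * x 7 + tb (x 0) (x 1) * x 8, 0]
            (Matrix.reindex finSumFinEquiv finSumFinEquiv
              (Matrix.fromBlocks
                !![e (x 0) (x 1), g (x 0) (x 1), p (x 0) (x 1);
                   g (x 0) (x 1), f (x 0) (x 1), q' (x 0) (x 1);
                   p (x 0) (x 1), q' (x 0) (x 1), t (x 0) (x 1)]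
                0 0
                !![e (x 0) (x 1), g (x 0) (x 1), p (x 0) (x 1);
                   g (x 0) (x 1), f (x 0) (x 1), q' (x 0) (x 1);
                   p (x 0) (x 1), q' (x 0) (x 1), t (x 0) (x 1)]))) : Matrix (Fin 9) (Fin 9) ℝ)) :=
    ⟨_, fun _ => rfl⟩
  -- (1a) excise the null set `N = {x 0 = 0, x 1 = 0, x 2 ≤ 0}`
  have hN : IsSemialgebraic ℚ {x : Fin 9 → ℝ | x 0 = 0 ∧ x 1 = 0 ∧ x 2 ≤ 0} := by
    have h0 := isSemialgebraic_setOf_eval_eq_zero (k := ℚ) (R := ℝ)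
      (MvPolynomial.X 0 : MvPolynomial (Fin 9) ℚ)
    have h1 := isSemialgebraic_setOf_eval_eq_zero (k := ℚ) (R := ℝ)
      (MvPolynomial.X 1 : MvPolynomial (Fin 9) ℚ)
    have h2 := isSemialgebraic_setOf_eval_nonneg (k := ℚ) (R := ℝ)
      (-MvPolynomial.X 2 : MvPolynomial (Fin 9) ℚ)
    convert (h0.inter h1).inter h2 using 1
    ext x
    simp [and_assoc]
  have hE : IsSemialgebraic ℚ (r.domain \ {x | x 0 = 0 ∧ x 1 = 0 ∧ x 2 ≤ 0}) :=
    r.isSemialgebraic_domain.diff hN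
  have hEr : r.domain \ {x | x 0 = 0 ∧ x 1 = 0 ∧ x 2 ≤ 0} ⊆ r.domain := fun x hx => hx.1
  have hvol : volume (r.domain \ (r.domain \ {x : Fin 9 → ℝ | x 0 = 0 ∧ x 1 = 0 ∧ x 2 ≤ 0})) = 0 := by
    have hplane : volume {x : Fin 9 → ℝ | x 0 = 0} = 0 := by
      rw [volume_pi]
      exact Measure.pi_hyperplane _ 0 0
    refine measure_mono_null (fun x hx => ?_) hplane
    have hxN : x ∈ {x : Fin 9 → ℝ | x 0 = 0 ∧ x 1 = 0 ∧ x 2 ≤ 0} := by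
      by_contra h
      exact hx.2 ⟨hx.1, h⟩
    exact hxN.1
  have h1 : KZ.of r - KZ.of (r.restrict _ hE hEr) ∈ KZ.relations :=
    KZ.IntegralRep.of_sub_of_restrict_mem_relations r hE hEr hvol
  -- (2) one change of variables from `q` onto `[σ ∖ N, 1]`
  have himage : Ψ '' q.domain = r.domain \ {x | x 0 = 0 ∧ x 1 = 0 ∧ x 2 ≤ 0} := by
    rw [hq]
    exact chart_image hp hq' ht he hf hg hΨ r.domain hO
  have h2 : KZ.of q - KZ.of (r.restrict _ hE hEr) ∈ KZ.relations := by
    refine KZ.changeOfVariablesRel_subset_relations ⟨9, q, r.restrict _ hE hEr, Ψ, Ψ',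
      chart_isSemialgebraicMapOn hp hq' ht he hf hg hΨ q.isSemialgebraic_domain,
      fun x _ => (chart_hasFDerivAt hp hq' ht he hf hg hpa hpb hqa hqb hta htb hea heb hfa hfb hga hgb
        hΨ hΨ' x).hasFDerivWithinAt,
      (chart_injOn hp hq' ht he hf hg hΨ).mono (fun w hw => ?_), himage.symm, fun x hx => ?_, rfl⟩
    · rw [hq] at hw
      exact hw.1
    · have hxE : Ψ x ∈ r.domain \ {x | x 0 = 0 ∧ x 1 = 0 ∧ x 2 ≤ 0} := himage ▸ mem_image_of_mem Ψ hx
      rw [hq1 x hx, KZ.IntegralRep.integrand_restrict, hr1 _ hxE.1,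
        chart_det hp hq' ht he hf hg hpa hpb hqa hqb hta htb hΨ' x, abs_of_nonneg (by positivity)]
      ring
  have e : KZ.of r - KZ.of q =
      (KZ.of r - KZ.of (r.restrict _ hE hEr)) - (KZ.of q - KZ.of (r.restrict _ hE hEr)) := by
    abel
  rw [e]
  exact KZ.relations.sub_mem h1 h2

end Summit.KontsevichZagierPeriods.InverseLandau

end
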